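import Summits.CriticalPhenomena.PercolationContinuityZ3.Theorems.Transplant.FreeNilpotentPointGroup
import Summits.CriticalPhenomena.PercolationContinuityZ3.Theorems.Transplant.SlabQuotientCriterion
import Summits.CriticalPhenomena.PercolationContinuityZ3.Theorems.TransplantHeisenbergZSlabCritical
import HarnessLib

/-!
# The columns of `Cay(N_{m,2})`: quasi-transitive intermediate subgraphs carrying a free central-transversal action
# (the data of the slab–quotient criterion for the rank-`m` skeleton)

builds on p205010 (kernel theorem, internal audit signed; external expert review pending) — nothing in this file uses p205010.
Lane `prim-bschramm`, seat `prim-bschramm-p4` (gen 4; class map, memo `P4-GENERAL.md` §11.4/§12), helper file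
(`--supports stmt-CriticalPhenomena-4575`).  Third file of the `FreeNilpotent*` series; pattern of `HeisenbergZSlabA.lean` (p220054).

THE COLUMN TRICK (memo §11.4, "(Z-column)").  Fix a free direction `i₀`.  The column
  `Σ = fnCol i₀ L = {(v,c) : |v_i| ≤ L for all i ≠ i₀}`  (all of `v_{i₀}` and the whole centre free)
contains every cylinder `Cyl_ℓ = {|v_i| ≤ ℓ ∀ i}` of the rank-`m` skeleton (`ℓ ≤ L`).  The subgroup `K = {v_i = 0 ∀ i ≠ i₀} = ⟨e_{i₀}⟩·Z`
is ABELIAN (`β(δ_{i₀}, δ_{i₀}) = 0` and `Z` is central), its left translations `(v,c) ↦ (v + t δ_{i₀}, c + c₀ + β(t δ_{i₀}, v))` keep the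
column and are graph automorphisms (`colShift`), with the `(2L+1)^{m−1}`-element transversal `{(v,0) : v_{i₀} = 0}` (`fnColGraph_quasiTransitive`);
`Γ_N = ⟨e_{i₀}^N⟩ ≤ K` (type synonym `CShift i₀ N ≅ ℤ`, left multiplication by `(nN δ_{i₀}, 0)`) acts freely by automorphisms, commutes with
all of `K` (`colShift_smul`), so the quotient `Γ_N \ Σ` is quasi-transitive (`cQuotient_quasiTransitive`, descent by `quotIsoOfEquivariant`);
and for `N = 2ℓ+2` the cylinder meets each `Γ_N`-orbit at most once with no edge to its translates (`eq_one_of_smul_mem_cyl`,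
`eq_one_of_adj_smul_cyl`).  Connectivity and `p_c(Σ) < 1` are the next two files; the criterion is applied in `FreeNilpotentCylSubcritical.lean`.
[cite: MartineauSevero2019, Cor. 2.2 (hypotheses: free action by automorphisms, quasi-transitive graph and quotient)]
[cite: BenjaminiSchramm1996, §2 (quasi-transitive graphs)]
-/

noncomputable section

namespace Summit.CriticalPhenomena.PercolationContinuityZ3.Theorems.Transplant

open MeasureTheory Literature.Probability.Percolation Literature.Probability.LatticeModels SimpleGraph
open Literature.Barriers.CriticalPhenomena (IsQuasiTransitive)
open Summit.CriticalPhenomena.PercolationContinuityZ3.Theorems.HeisenbergZ (quotIsoOfEquivariant)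

variable {m : ℕ}

/-! ## §1 The column `Σ = {|v_i| ≤ L, i ≠ i₀}` -/

/-- The column in the free direction `i₀`: all skeleton coordinates but `v_{i₀}` bounded by `L`; centre free. [folklore] -/
def fnCol (i₀ : Fin m) (L : ℕ) : Set (FN m) := {x | ∀ i, i ≠ i₀ → |x.1 i| ≤ L}

/-- The induced column graph `G[Σ]`. [folklore] -/
abbrev fnColGraph (i₀ : Fin m) (L : ℕ) : SimpleGraph (fnCol i₀ L) := (fnGraph m).induce (fnCol i₀ L)

/-- Membership, unfolded. [folklore] -/
theorem mem_fnCol_iff {i₀ : Fin m} {L : ℕ} {x : FN m} : x ∈ fnCol i₀ L ↔ ∀ i, i ≠ i₀ → |x.1 i| ≤ L := Iff.rfl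

/-- `1 ∈ Σ`. [folklore] -/
theorem zero_mem_fnCol (i₀ : Fin m) (L : ℕ) : (0 : FN m) ∈ fnCol i₀ L := fun i _ => by simp

/-- The column origin. [folklore] -/
abbrev fnColOrigin (i₀ : Fin m) (L : ℕ) : fnCol i₀ L := ⟨0, zero_mem_fnCol i₀ L⟩

/-- Membership depends on the skeleton coordinates only. [folklore] -/
theorem mem_fnCol_of_fst_eq {i₀ : Fin m} {L : ℕ} {x y : FN m} (h : x.1 = y.1) (hy : y ∈ fnCol i₀ L) : x ∈ fnCol i₀ L :=
  fun i hi => by rw [h]; exact hy i hi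

/-- Induced subgraphs of `fnGraph m` are locally finite. [folklore] -/
instance fnGraph_induce_locallyFinite (s : Set (FN m)) : ((fnGraph m).induce s).LocallyFinite := fun x =>
  ((((fnGraph m).neighborSet x.1).toFinite.preimage Subtype.val_injective.injOn).subset
    fun y (hy : ((fnGraph m).induce s).Adj x y) => by simpa [SimpleGraph.mem_neighborSet] using hy).fintype

/-- **The cylinders of the rank-`m` skeleton lie in the column** (`ℓ ≤ L`). [folklore] -/
theorem fnSkeleton_cyl_subset_fnCol (i₀ : Fin m) {ℓ L : ℕ} (h : ℓ ≤ L) : (fnSkeleton m).cyl 0 ℓ ⊆ fnCol i₀ L := by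
  intro w hw i _
  rw [mem_fnSkeleton_cyl, mem_box] at hw
  have := hw i
  rw [abs_le]
  constructor <;> linarith [this.1, this.2, (Int.ofNat_le.2 h : (ℓ : ℤ) ≤ L)]

/-! ## §2 The column's symmetries: left translations by `K = ⟨e_{i₀}⟩ · Z` (abelian) -/

/-- The element `k(t, c₀) = (t δ_{i₀}, c₀) ∈ K`. [folklore] -/
def kElt (i₀ : Fin m) (t : ℤ) (c₀ : Pr m → ℤ) : FN m := (Pi.single i₀ t, c₀)

/-- Left translation by `k(t,c₀)` keeps every skeleton coordinate `i ≠ i₀`. [folklore] -/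
theorem fnMul_kElt_fst_of_ne (i₀ : Fin m) (t : ℤ) (c₀ : Pr m → ℤ) (x : FN m) {i : Fin m} (hi : i ≠ i₀) :
    (fnMul (kElt i₀ t c₀) x).1 i = x.1 i := by
  simp [kElt, hi]

/-- … and shifts `v_{i₀}` by `t`. [folklore] -/
theorem fnMul_kElt_fst_self (i₀ : Fin m) (t : ℤ) (c₀ : Pr m → ℤ) (x : FN m) :
    (fnMul (kElt i₀ t c₀) x).1 i₀ = x.1 i₀ + t := by
  simp [kElt, add_comm]

/-- Left translation by `K` preserves the column. [folklore] -/
theorem fnMul_kElt_mem_fnCol {i₀ : Fin m} {L : ℕ} (t : ℤ) (c₀ : Pr m → ℤ) {x : FN m} :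
    fnMul (kElt i₀ t c₀) x ∈ fnCol i₀ L ↔ x ∈ fnCol i₀ L := by
  simp only [mem_fnCol_iff]
  refine forall_congr' fun i => forall_congr' fun hi => ?_
  rw [fnMul_kElt_fst_of_ne i₀ t c₀ x hi]

/-- `K` is abelian: `k(t,c₀) · k(t',c₀') = k(t+t', c₀+c₀')` (no cocycle term, `β(δ_{i₀}, δ_{i₀}) = 0`). [folklore] -/
theorem kElt_mul (i₀ : Fin m) (t t' : ℤ) (c₀ c₀' : Pr m → ℤ) :
    fnMul (kElt i₀ t c₀) (kElt i₀ t' c₀') = kElt i₀ (t + t') (c₀ + c₀') := by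
  refine Prod.ext ?_ ?_
  · simp [kElt, Pi.single_add]
  · simp [kElt]

/-- `k(t,c₀)⁻¹ = k(−t, −c₀)`. [folklore] -/
theorem kElt_mul_neg (i₀ : Fin m) (t : ℤ) (c₀ : Pr m → ℤ) : fnMul (kElt i₀ t c₀) (kElt i₀ (-t) (-c₀)) = 0 := by
  rw [kElt_mul]; simp [kElt]

/-- Left translation by `k(t,c₀)` maps the column bijectively onto itself. [folklore] -/
theorem fnLeftIso_kElt_bijOn (i₀ : Fin m) (L : ℕ) (t : ℤ) (c₀ : Pr m → ℤ) :
    Set.BijOn (fnLeftIso (kElt i₀ t c₀)) (fnCol i₀ L) (fnCol i₀ L) := by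
  refine Set.BijOn.mk (fun x hx => ?_) ((fnMul_right_injective _).injOn) (fun y hy => ?_)
  · rw [fnLeftIso_apply]; exact (fnMul_kElt_mem_fnCol t c₀).2 hx
  · refine ⟨fnMul (kElt i₀ (-t) (-c₀)) y, (fnMul_kElt_mem_fnCol (-t) (-c₀)).2 hy, ?_⟩
    rw [fnLeftIso_apply, ← fnMul_assoc, kElt_mul_neg, zero_fnMul]

/-- **The column shift by `k(t,c₀)` as an automorphism of the column graph.** [folklore] -/
def colShift (i₀ : Fin m) (L : ℕ) (t : ℤ) (c₀ : Pr m → ℤ) : fnColGraph i₀ L ≃g fnColGraph i₀ L :=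
  (fnLeftIso (kElt i₀ t c₀)).induce (fnLeftIso_kElt_bijOn i₀ L t c₀)

/-- The shift acts by left multiplication on the underlying vertex. [folklore] -/
@[simp] theorem colShift_apply_val (i₀ : Fin m) (L : ℕ) (t : ℤ) (c₀ : Pr m → ℤ) (x : fnCol i₀ L) :
    ((colShift i₀ L t c₀ x : fnCol i₀ L) : FN m) = fnMul (kElt i₀ t c₀) x := rfl

/-- The transversal `{(v, 0) : v_{i₀} = 0, |v_i| ≤ L}` of the `K`-orbits on the column. [folklore] -/
def fnColReps (i₀ : Fin m) (L : ℕ) : Finset (FN m) :=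
  (Fintype.piFinset fun _ : Fin m => Finset.Icc (-(L : ℤ)) L).image fun v => (Function.update v i₀ 0, 0)

/-- The shift by `k(−v_{i₀}, −c − β(−v_{i₀} δ_{i₀}, v))` brings `(v, c)` to the representative `(v with v_{i₀} := 0, 0)`. [folklore] -/
theorem colShift_to_rep (i₀ : Fin m) (L : ℕ) (x : fnCol i₀ L) :
    fnMul (kElt i₀ (-(x : FN m).1 i₀) (-(x : FN m).2 - fnBeta (Pi.single i₀ (-(x : FN m).1 i₀)) (x : FN m).1)) x =
      (Function.update (x : FN m).1 i₀ 0, 0) := by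
  refine Prod.ext (funext fun i => ?_) ?_
  · by_cases hi : i = i₀
    · subst hi; simp [kElt]
    · rw [fnMul_kElt_fst_of_ne i₀ _ _ _ hi]
      exact (Function.update_of_ne hi _ _).symm
  · simp only [fnMul_snd, kElt]; abel

/-- The representative of `x` lies in the transversal. [folklore] -/
theorem rep_mem_fnColReps (i₀ : Fin m) (L : ℕ) (x : fnCol i₀ L) :
    ((Function.update (x : FN m).1 i₀ 0, 0) : FN m) ∈ fnColReps i₀ L := by
  classical
  rw [fnColReps, Finset.mem_image]
  refine ⟨Function.update (x : FN m).1 i₀ 0, ?_, by simp⟩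
  rw [Fintype.mem_piFinset]
  intro i
  rw [Finset.mem_Icc]
  by_cases hi : i = i₀
  · subst hi; simp
  · rw [Function.update_of_ne hi]
    exact abs_le.1 (x.2 i hi)

/-- **The column graph is quasi-transitive** (finitely many `K`-orbits). [folklore] -/
theorem fnColGraph_quasiTransitive (i₀ : Fin m) (L : ℕ) : IsQuasiTransitive (fnColGraph i₀ L) := by
  classical
  refine ⟨(fnColReps i₀ L).subtype (· ∈ fnCol i₀ L), fun x =>
    ⟨colShift i₀ L (-(x : FN m).1 i₀) (-(x : FN m).2 - fnBeta (Pi.single i₀ (-(x : FN m).1 i₀)) (x : FN m).1), ?_⟩⟩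
  rw [Finset.mem_subtype, colShift_apply_val, colShift_to_rep]
  exact rep_mem_fnColReps i₀ L x

/-! ## §3 The free action of `Γ_N = ⟨e_{i₀}^N⟩` by left multiplication -/

/-- `Γ_N ≅ ℤ` (type synonym of `Multiplicative ℤ`, so that its actions do not pollute the instance table). [folklore] -/
def CShift (_i₀ : Fin m) (_N : ℕ) : Type := Multiplicative ℤ

/-- `Γ_N` is a group. [folklore] -/
instance (i₀ : Fin m) (N : ℕ) : Group (CShift i₀ N) := inferInstanceAs (Group (Multiplicative ℤ))
/-- `Γ_N` is non-trivial. [folklore] -/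
instance (i₀ : Fin m) (N : ℕ) : Nontrivial (CShift i₀ N) := inferInstanceAs (Nontrivial (Multiplicative ℤ))

/-- The exponent `n` of `g = e_{i₀}^{Nn}`. [folklore] -/
def CShift.exp {i₀ : Fin m} {N : ℕ} (g : CShift i₀ N) : ℤ := Multiplicative.toAdd (show Multiplicative ℤ from g)

/-- `exp 1 = 0`. [folklore] -/
@[simp] theorem CShift.exp_one {i₀ : Fin m} {N : ℕ} : (1 : CShift i₀ N).exp = 0 := rfl
/-- `exp (g h) = exp g + exp h`. [folklore] -/
@[simp] theorem CShift.exp_mul {i₀ : Fin m} {N : ℕ} (g h : CShift i₀ N) : (g * h).exp = g.exp + h.exp := rfl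
/-- `exp` is injective. [folklore] -/
theorem CShift.exp_injective {i₀ : Fin m} {N : ℕ} : Function.Injective (CShift.exp (i₀ := i₀) (N := N)) :=
  fun _ _ h => Multiplicative.toAdd.injective h

/-- `e_{i₀}^{Nn} · x`: LEFT multiplication by `k(Nn, 0)`. [folklore] -/
instance (i₀ : Fin m) (N : ℕ) : MulAction (CShift i₀ N) (FN m) where
  smul g x := fnMul (kElt i₀ (N * g.exp) 0) x
  one_smul x := by
    show fnMul (kElt i₀ (N * (1 : CShift i₀ N).exp) 0) x = x
    rw [CShift.exp_one, mul_zero]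
    have : kElt i₀ 0 0 = (0 : FN m) := Prod.ext (by simp [kElt]) rfl
    rw [this, zero_fnMul]
  mul_smul g h x := by
    show fnMul (kElt i₀ (N * (g * h).exp) 0) x = fnMul (kElt i₀ (N * g.exp) 0) (fnMul (kElt i₀ (N * h.exp) 0) x)
    rw [← fnMul_assoc, kElt_mul, CShift.exp_mul, mul_add, add_zero]

/-- The action, unfolded. [folklore] -/
theorem CShift.smul_def {i₀ : Fin m} {N : ℕ} (g : CShift i₀ N) (x : FN m) : g • x = fnMul (kElt i₀ (N * g.exp) 0) x := rfl

/-- The action keeps the skeleton coordinates `i ≠ i₀` … [folklore] -/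
theorem CShift.smul_fst_of_ne {i₀ : Fin m} {N : ℕ} (g : CShift i₀ N) (x : FN m) {i : Fin m} (hi : i ≠ i₀) :
    (g • x).1 i = x.1 i := by
  rw [CShift.smul_def]; exact fnMul_kElt_fst_of_ne i₀ _ _ x hi

/-- … and shifts `v_{i₀}` by `N · exp g`. [folklore] -/
theorem CShift.smul_fst_self {i₀ : Fin m} {N : ℕ} (g : CShift i₀ N) (x : FN m) : (g • x).1 i₀ = x.1 i₀ + N * g.exp := by
  rw [CShift.smul_def]; exact fnMul_kElt_fst_self i₀ _ _ x

/-- The action preserves the column. [folklore] -/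
theorem CShift.smul_mem_fnCol {i₀ : Fin m} {N L : ℕ} (g : CShift i₀ N) {x : FN m} : g • x ∈ fnCol i₀ L ↔ x ∈ fnCol i₀ L := by
  rw [CShift.smul_def]; exact fnMul_kElt_mem_fnCol _ _

/-- The induced action of `Γ_N` on the column. [folklore] -/
instance (i₀ : Fin m) (N L : ℕ) : MulAction (CShift i₀ N) (fnCol i₀ L) where
  smul g x := ⟨g • (x : FN m), (CShift.smul_mem_fnCol g).2 x.2⟩
  one_smul x := Subtype.ext (one_smul (CShift i₀ N) (x : FN m))
  mul_smul g h x := Subtype.ext (mul_smul g h (x : FN m))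

/-- The column action on the underlying vertex. [folklore] -/
@[simp] theorem CShift.coe_smul {i₀ : Fin m} {N L : ℕ} (g : CShift i₀ N) (x : fnCol i₀ L) :
    ((g • x : fnCol i₀ L) : FN m) = g • (x : FN m) := rfl

/-- The action on the column is by graph automorphisms (restriction of a left translation). [folklore] -/
theorem cShift_isActionByAut (i₀ : Fin m) (N L : ℕ) : IsActionByAut (fnColGraph i₀ L) (CShift i₀ N) := by
  intro g x y
  show (fnGraph m).Adj ((g • x : fnCol i₀ L) : FN m) ((g • y : fnCol i₀ L) : FN m) ↔ (fnGraph m).Adj (x : FN m) (y : FN m)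
  rw [CShift.coe_smul, CShift.coe_smul, CShift.smul_def, CShift.smul_def]
  exact (fnLeftIso _).map_rel_iff'

/-- The action on the column is free (`N ≠ 0`). [folklore] -/
theorem cShift_free {i₀ : Fin m} {N L : ℕ} (hN : N ≠ 0) (g : CShift i₀ N) (x : fnCol i₀ L) (h : g • x = x) : g = 1 := by
  have h1 := congrArg (fun y : fnCol i₀ L => (y : FN m).1 i₀) h
  simp only [CShift.coe_smul, CShift.smul_fst_self] at h1
  have : (N : ℤ) * g.exp = 0 := by linarith
  have hexp : g.exp = 0 := by
    rcases mul_eq_zero.1 this with h | h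
    · exact absurd (by exact_mod_cast h) hN
    · exact h
  exact CShift.exp_injective (by simpa using hexp)

/-! ## §4 The quotient `Γ_N \ Σ` is quasi-transitive: the column shifts commute with `Γ_N` and descend -/

/-- `K` is abelian: the column shifts commute with `Γ_N`. [folklore] -/
theorem colShift_smul {i₀ : Fin m} {N L : ℕ} (t : ℤ) (c₀ : Pr m → ℤ) (g : CShift i₀ N) (x : fnCol i₀ L) :
    colShift i₀ L t c₀ (g • x) = g • colShift i₀ L t c₀ x := by
  apply Subtype.ext
  rw [CShift.coe_smul, colShift_apply_val, colShift_apply_val, CShift.coe_smul, CShift.smul_def, CShift.smul_def,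
    ← fnMul_assoc, ← fnMul_assoc, kElt_mul, kElt_mul, add_comm t, add_comm c₀]

/-- **`Γ_N \ Σ` is quasi-transitive**: the descended shifts bring every orbit to the orbit of a representative. [folklore] -/
theorem cQuotient_quasiTransitive (i₀ : Fin m) (N L : ℕ) :
    IsQuasiTransitive (orbitQuotientGraph (fnColGraph i₀ L) (CShift i₀ N)) := by
  classical
  refine ⟨((fnColReps i₀ L).subtype (· ∈ fnCol i₀ L)).image (qmk (CShift i₀ N)), fun u => ?_⟩
  induction u using Quotient.inductionOn' with
  | h x =>
  set t : ℤ := -(x : FN m).1 i₀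
  set c₀ : Pr m → ℤ := -(x : FN m).2 - fnBeta (Pi.single i₀ (-(x : FN m).1 i₀)) (x : FN m).1
  refine ⟨quotIsoOfEquivariant (cShift_isActionByAut i₀ N L) (colShift i₀ L t c₀) (fun g y => colShift_smul t c₀ g y), ?_⟩
  show qmk (CShift i₀ N) (colShift i₀ L t c₀ x) ∈ ((fnColReps i₀ L).subtype (· ∈ fnCol i₀ L)).image (qmk (CShift i₀ N))
  refine Finset.mem_image_of_mem _ (Finset.mem_subtype.2 ?_)
  rw [colShift_apply_val, colShift_to_rep]
  exact rep_mem_fnColReps i₀ L x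

/-! ## §5 The cylinder inside the column: conditions (i), (ii) of the slab–quotient criterion for `N = 2ℓ + 2` -/

/-- In a cylinder, `|v_{i₀}| ≤ ℓ`. [folklore] -/
theorem abs_fst_le_of_mem_cyl {ℓ : ℕ} {y : FN m} (hy : y ∈ (fnSkeleton m).cyl 0 ℓ) (i : Fin m) : |y.1 i| ≤ ℓ := by
  rw [mem_fnSkeleton_cyl, mem_box] at hy
  exact abs_le.2 (hy i)

/-- A non-zero multiple of `N = 2ℓ+2` has absolute value `> 2ℓ + 1`. [folklore] -/
theorem exp_eq_zero_of_abs_mul_le {ℓ : ℕ} {n : ℤ} (h : |((2 * ℓ + 2 : ℕ) : ℤ) * n| ≤ 2 * ℓ + 1) : n = 0 := by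
  by_contra hn
  have h1 : (1 : ℤ) ≤ |n| := Int.one_le_abs hn
  rw [abs_mul] at h
  have h2 : |((2 * ℓ + 2 : ℕ) : ℤ)| = 2 * ℓ + 2 := by push_cast; exact abs_of_nonneg (by positivity)
  rw [h2] at h
  nlinarith

/-- **(i) The cylinder `Cyl_ℓ` meets each `Γ_{2ℓ+2}`-orbit at most once.** [folklore] -/
theorem eq_one_of_smul_mem_cyl {i₀ : Fin m} {ℓ L : ℕ} (g : CShift i₀ (2 * ℓ + 2)) (y : fnCol i₀ L)
    (hy : (y : FN m) ∈ (fnSkeleton m).cyl 0 ℓ) (hgy : ((g • y : fnCol i₀ L) : FN m) ∈ (fnSkeleton m).cyl 0 ℓ) : g = 1 := by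
  have h1 := abs_fst_le_of_mem_cyl hy i₀
  have h2 := abs_fst_le_of_mem_cyl hgy i₀
  rw [CShift.coe_smul, CShift.smul_fst_self] at h2
  have h3 : |(((2 * ℓ + 2 : ℕ) : ℤ)) * g.exp| ≤ 2 * ℓ + 1 := by
    rw [abs_le] at h1 h2 ⊢
    constructor <;> linarith [h1.1, h1.2, h2.1, h2.2]
  exact CShift.exp_injective (by simpa using exp_eq_zero_of_abs_mul_le h3)

/-- **(ii) No edge of the column joins the cylinder to a non-trivial `Γ_{2ℓ+2}`-translate of the cylinder.** [folklore] -/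
theorem eq_one_of_adj_smul_cyl {i₀ : Fin m} {ℓ L : ℕ} (g : CShift i₀ (2 * ℓ + 2)) (y z : fnCol i₀ L)
    (hy : (y : FN m) ∈ (fnSkeleton m).cyl 0 ℓ) (hz : (z : FN m) ∈ (fnSkeleton m).cyl 0 ℓ)
    (hadj : (fnColGraph i₀ L).Adj y (g • z)) : g = 1 := by
  have h1 := abs_fst_le_of_mem_cyl hy i₀
  have h2 := abs_fst_le_of_mem_cyl hz i₀
  have hadj' : (fnGraph m).Adj (y : FN m) (g • (z : FN m)) := hadj
  have h3 := abs_fst_sub_le_one hadj' i₀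
  rw [CShift.smul_fst_self] at h3
  have h4 : |(((2 * ℓ + 2 : ℕ) : ℤ)) * g.exp| ≤ 2 * ℓ + 1 := by
    rw [abs_le] at h1 h2 h3 ⊢
    constructor <;> linarith [h1.1, h1.2, h2.1, h2.2, h3.1, h3.2]
  exact CShift.exp_injective (by simpa using exp_eq_zero_of_abs_mul_le h4)

end Summit.CriticalPhenomena.PercolationContinuityZ3.Theorems.Transplant

end
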